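import Literature.Barriers.CriticalPhenomena.GaussianDominationRouteNobleProofs
import Literature.Barriers.CriticalPhenomena.LaceExpansionHighDimension
import HarnessLib

/-!
# Fitzner–van der Hofstad 2017, §7: the numerical condition behind Thm. 1.4 (`η = 0` in `x`-space,
# `d ≥ 11`) — typed as an EXPLICIT OPEN HYPOTHESIS (lace packet, GAPS G3)

Fitzner–van der Hofstad, *Mean-field behavior for nearest-neighbor percolation in `d > 10`*,
Electron. J. Probab. **22** (2017) no. 43, §7 "Proof of Theorem 1.4", pp. 61–62, verbatim:

> "The proof of Theorem 1.4 follows by using the `x`-space asymptotics proved by Takashi Hara in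
> [Hara08]. See in particular [Hara08, Proposition 1.3]. In more detail we use that, by our
> numerical computations in dimension `d = 11`,
> `T̄^{(0,0)} = sup_{x ∈ ℤ^d} (τ_{p_c}^{⋆3}(x) - δ_{0,x}) ≤ 0.53562`,
> `T_{p_c} = 2d p_c sup_{x ∈ ℤ^d} (τ_{p_c}^{⋆3} ⋆ D)(x) ≤ 0.28036`.   (7.1)
> In particular, by a recent improvement of the bounds by Hara compared to
> [Hara08, Proposition 1.3], it suffices to prove that
> `T_{p_c} (1 + 2 T̄^{(0,0)}) < 1`.   (7.2)
> … The improvement in (7.2) follows by carefully inspecting which triangles can be trivial and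
> which are not. … The bound in (7.2) follows from (7.1) and the estimate on
> `p_c(11) ≤ 0.048242`."

and Acknowledgements, p. 62: "We particularly thank Takashi Hara for sharing his handwritten
notes …". The accompanying notebook (Percolation.nb, §"Number required for the proof of
Section 7 (II)") says: "We rely on the conditions given to us by Takashi Hara (private
communication), and we rely on his work."

**Status in print.** (i) The SUFFICIENCY of (7.2) for the conclusion of Thm. 1.4 is attributed
to an unpublished improvement by Hara of [Hara08, Prop. 1.3]; no printed proof exists (searched:
see GAPS.md G3, oracle block). (ii) Hara 2008 itself (Ann. Probab. 36, §1.2) prints a complete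
percolation proof "only … for large `d` (say `d ≥ 30`)"; "Results for percolation in `d ≥ 19` can
be obtained by more detailed diagrammatic estimates which slightly improve conditions in
Lemmas 1.5 and 1.6 … not reproduced here." (iii) Liu–Slade, PTRF (2025), §1.3, replace Hara's
Gaussian Lemma but IMPORT the decay hypothesis (their Assumption 1.1) for nearest-neighbour
percolation `d ≥ 11` from [FH17]. (iv) Heydenreich–van der Hofstad 2017, Thm. 11.4, print the
statement for `d ≥ 11` with an informal proof sketch (§11.2), no condition.

Accordingly this file DEFINES the two printed quantities of (7.1) and the printed condition (7.2)
(`HaraSharpenedCondition d`), checks the printed arithmetic "(7.1) ⇒ (7.2)" at `d = 11` in the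
kernel, and writes the unprinted implication "(7.2) suffices" ONLY as an explicit binder
`(hH : TriangleCondition 11 → HaraSharpenedCondition 11 → EtaZeroXSpace 11)` of the dependency
statement `etaZeroXSpace_d11_of_openHypothesis` — an OPEN HYPOTHESIS of the packet: not a named
fact, not citable (private communications and programme-internal claims never enter as facts;
a conjecture `def` does not belong in `Literature/`). Theorem 1.4 is OUTSIDE the lace packet's
ladder (IRB ⇒ triangle ⇒ exponents; REFEREE ruling G3); nothing on that ladder imports this file.

## References

* [FvdH17] R. Fitzner, R. van der Hofstad, Electron. J. Probab. 22 (2017) no. 43: Thm. 1.4 p. 6;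
  §7 (7.1)–(7.2) pp. 61–62; Acknowledgements p. 62.
* [Hara08] T. Hara, Ann. Probab. 36 (2008) 530–593: Prop. 1.3 p. 535; §1.2 (scope sentence);
  Lemmas 1.5–1.7.
* [LiuSlade] Y. Liu, G. Slade, Gaussian deconvolution and the lace expansion, Probab. Theory
  Related Fields (2025), doi:10.1007/s00440-024-01350-9, Assumption 1.1 and §1.3.
* [HvdH17] M. Heydenreich, R. van der Hofstad, Progress in High-Dimensional Percolation and
  Random Graphs (Springer 2017), Thm. 11.4 and §11.2.
-/

noncomputable section

namespace Literature.Probability.FitznerVanDerHofstad2017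

open Literature.Probability.LatticeModels Literature.Probability.Percolation
  Literature.Barriers.CriticalPhenomena
open SpreadOutIsing (delta0 latticeConv convPow)

/-- **`T̄^{(0,0)} := sup_{x ∈ ℤ^d} (τ_{p_c}^{⋆3}(x) - δ_{0,x})`** (Fitzner–van der Hofstad 2017,
(7.1); the critical two-point function `τ_{p_c}(x) = τ_{p_c}(0,x)` of the tree, lattice
convolution powers `convPow` as in `nobleH`; a real `iSup`, `= 0` if unbounded).
[cite: FitznerVanDerHofstad2017, §7 (7.1), EJP p. 61] -/
def criticalTbar00 (d : ℕ) : ℝ :=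
  ⨆ x : Site d, (convPow (tau d (criticalProbI d) 0) 3 x - if x = 0 then (1 : ℝ) else 0)

/-- **`T_{p_c} := 2d p_c sup_{x ∈ ℤ^d} (τ_{p_c}^{⋆3} ⋆ D)(x)`** with `D` the nearest-neighbour
step distribution `srwStep d` (Fitzner–van der Hofstad 2017, (7.1)).
[cite: FitznerVanDerHofstad2017, §7 (7.1), EJP p. 61] -/
def criticalTpc (d : ℕ) : ℝ :=
  2 * d * (criticalProbI d : ℝ) *
    ⨆ x : Site d, latticeConv (convPow (tau d (criticalProbI d) 0) 3) (srwStep d) x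

/-- **Condition (7.2)**: `T_{p_c} (1 + 2 T̄^{(0,0)}) < 1` — "by a recent improvement of the bounds
by Hara compared to [Hara08, Proposition 1.3], it suffices to prove that
`T_{p_c}(1 + 2T̄^{(0,0)}) < 1`". [cite: FitznerVanDerHofstad2017, §7 (7.2), EJP pp. 61–62] -/
def HaraSharpenedCondition (d : ℕ) : Prop :=
  criticalTpc d * (1 + 2 * criticalTbar00 d) < 1

/-- `T_{p_c} ≥ 0` (all factors are non-negative; an unbounded supremum is `0` by convention).
[folklore] -/
theorem criticalTpc_nonneg (d : ℕ) : 0 ≤ criticalTpc d := by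
  unfold criticalTpc
  refine mul_nonneg (mul_nonneg (mul_nonneg zero_le_two (Nat.cast_nonneg d))
    (unitInterval.nonneg (criticalProbI d))) ?_
  exact Real.iSup_nonneg fun x => latticeConv_nonneg
    (convPow_nonneg_of_nonneg (fun y => tau_nonneg _ _ _) 3) (fun y => srwStep_nonneg y) x

/-- **The arithmetic of §7 at `d = 11`, kernel-checked**: the printed bounds (7.1) — "by our
numerical computations in dimension `d = 11`, `T̄^{(0,0)} ≤ 0.53562`, `T_{p_c} ≤ 0.28036`", a
COMPUTATIONAL CLAIM of the paper which the packet would re-derive by certified numerics, never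
cite — imply (7.2): `0.28036 · (1 + 2 · 0.53562) = 0.5806928… < 1` ("The bound in (7.2) follows
from (7.1) …").
[cite: FitznerVanDerHofstad2017, §7, EJP p. 62 ("The bound in (7.2) follows from (7.1)")] -/
theorem haraSharpenedCondition_d11_of_eq71 (hTb : criticalTbar00 11 ≤ 0.53562)
    (hTp : criticalTpc 11 ≤ 0.28036) : HaraSharpenedCondition 11 := by
  have h0 := criticalTpc_nonneg 11
  unfold HaraSharpenedCondition
  nlinarith [mul_nonneg h0 (sub_nonneg.2 hTb)]

/-- **How [FvdH17] Thm. 1.4 at `d = 11` depends on the non-printed step** (documentation of the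
dependency, not a result). The binder `hH` — "(7.2) suffices": the triangle condition (standing
for the lace-expansion inputs of Thm. 1.1 at `d = 11`) and (7.2) imply the `x`-space asymptotics
`EtaZeroXSpace 11` (the printed form of Thm. 1.4 / [HvdH17] Thm. 11.4) — is the OPEN HYPOTHESIS
of GAPS G3: asserted in print ([FvdH17] §7: "by a recent improvement of the bounds by Hara compared
to [Hara08, Proposition 1.3], it suffices to prove (7.2)") with its proof attributed to unpublished
notes of T. Hara ("private communication", Percolation.nb); [Hara08] §1.2 prints a complete
percolation proof only "for large `d` (say `d ≥ 30`)". It is deliberately NOT a named `def`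
(neither a Literature fact nor a summit obligation); the other binders are the triangle condition
(the packet's Cor. 1.3 at `d = 11`) and the computational claim (7.1).
[cite: FitznerVanDerHofstad2017, Thm. 1.4 (EJP p. 6) and §7 (7.1)–(7.2) (EJP pp. 61–62)] -/
theorem etaZeroXSpace_d11_of_openHypothesis
    (hH : TriangleCondition 11 → HaraSharpenedCondition 11 → EtaZeroXSpace 11)
    (hT : TriangleCondition 11) (hTb : criticalTbar00 11 ≤ 0.53562)
    (hTp : criticalTpc 11 ≤ 0.28036) : EtaZeroXSpace 11 :=
  hH hT (haraSharpenedCondition_d11_of_eq71 hTb hTp)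

end Literature.Probability.FitznerVanDerHofstad2017

end
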